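import Mathlib.Combinatorics.SimpleGraph.Clique
import Mathlib.Algebra.BigOperators.Group.Finset.Basic
import HarnessLib

-- provenance: harness21/H21/H21/Prelude/CryptoQuantFine/FGCoreProblems.lean @ 01d621f (interim HEAD d8f2665); M5 mechanical rewrite
/-!
# Core problems of fine-grained complexity (trunk CryptoQuantFine, notion `fg_core_problems`)

Math-level (machine-free) predicates for the central problems of fine-grained complexity:

* Orthogonal Vectors (OV) and `k`-OV: R. Williams, *A new algorithm for optimal 2-constraint
  satisfaction and its implications*, TCS 2005; Boolean-function form following
  Choudhury et al. 2026.
* 3SUM and `k`-SUM: Gajentaan–Overmars, *On a class of `O(n²)` problems in computational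
  geometry*, CGTA 1995; Pătraşcu–Williams, *On the possibility of faster SAT algorithms*, SODA 2010.
* `k`-Dominating Set: Pătraşcu–Williams 2010.
* `k`-Clique: Chen–Huang–Kanj–Xia, *Strong computational lower bounds via parameterized
  complexity*, JCSS 2006.

## Mathlib

* `k`-Clique uses Mathlib's `SimpleGraph.CliqueFree` / `SimpleGraph.IsNClique`
  (`Mathlib.Combinatorics.SimpleGraph.Clique`): `HasKClique G k := ¬ G.CliqueFree k`.
* Mathlib (at this pin) has no notion of dominating set of a simple graph; we define the local
  predicate `Literature.Computability.Cryptography.IsDominatingSet` (closed-neighbourhood domination).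
* Mathlib has no OV / 3SUM notions. The predicate `AreOrthogonal u v` coincides with the lattice
  notion `Disjoint u v` on `Fin d → Bool` (`Pi.disjoint_iff`, `Bool` is a Boolean algebra); we
  keep the named predicate for readability and record the bridge `areOrthogonal_iff_disjoint`.

## Names vs outline

The outline (F3) planned `HasOrthogonalPair (A B : List _)`, `HasKOrthogonal`,
`HasDominatingSetCard` and `hasOrthogonalPair_comm`; this file (following the work item) ships
`OVInstance.HasOrthogonalPair` (bundled instance, as consumed by F6 `FGProblemZoo`),
`KOVInstance.HasOrthogonalTuple`, `HasDominatingSetOfCard`, and `areOrthogonal_comm` together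
with `OVInstance.hasOrthogonalPair_swap`.

## Design choices

* OV instances are bundled as a structure `OVInstance` (dimensions `n d` and two tables
  `Fin n → Fin d → Bool`), since the fine-grained problem zoo (outline F6) measures size by `n` and
  restricts `d`; both lists have the same length `n` (the standard normalisation).
* 3SUM is stated on a list `l : List ℤ` with three *distinct positions* `i < j < k` (values may
  coincide); `k`-SUM asks for a `k`-element set of positions summing to zero.
* The Boolean-function form `ovFn n d : (Fin 2 × Fin n × Fin d → Bool) → Bool` reads the input bits
  as two tables (`0 ↦ A`, `1 ↦ B`) and decides `HasOrthogonalPair`; its negation `notOVFn` is monotone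
  (flipping a `false` to `true` can only destroy orthogonal pairs). No circuit library is imported:
  these are plain functions.
* Decidability instances are provided (all predicates quantify over finite data), via
  `inferInstanceAs` after unfolding.
* Junk values: `HasKSum 0 l` holds for every `l` (empty sum) and `HasDominatingSetOfCard G k`
  holds for every `k` when `V` is empty; the target statements only use `k ≥ 2` / `k ≥ 3`.
-/

namespace Literature.Computability.Cryptography

open Finset

/-! ### Orthogonal vectors -/

/-- Two Boolean vectors `u v : Fin d → Bool` are *orthogonal* if their `ℤ`-inner product is `0`,
i.e. there is no coordinate where both are `true` (R. Williams 2005). [cite: Williams2005] -/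
def AreOrthogonal {d : ℕ} (u v : Fin d → Bool) : Prop :=
  ∀ i, ¬ (u i = true ∧ v i = true)

/-- `instance` — interim instance carried over undocumented from `harness21/H21/H21/Prelude/CryptoQuantFine/FGCoreProblems.lean:64` (docstring generated by the M5 import). [folklore] -/
instance {d : ℕ} (u v : Fin d → Bool) : Decidable (AreOrthogonal u v) :=
  inferInstanceAs (Decidable (∀ i, ¬ (u i = true ∧ v i = true)))

/-- Orthogonality of Boolean vectors is symmetric. [folklore] -/
theorem areOrthogonal_comm {d : ℕ} (u v : Fin d → Bool) :
    AreOrthogonal u v ↔ AreOrthogonal v u :=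
  ⟨fun h i hi => h i ⟨hi.2, hi.1⟩, fun h i hi => h i ⟨hi.2, hi.1⟩⟩

/-- `AreOrthogonal u v` is Mathlib's lattice-theoretic `Disjoint u v` in the Boolean algebra
`Fin d → Bool` (bridge lemma documenting the overlap with Mathlib). [folklore] -/
theorem areOrthogonal_iff_disjoint {d : ℕ} (u v : Fin d → Bool) :
    AreOrthogonal u v ↔ Disjoint u v := by
  rw [Pi.disjoint_iff]
  refine forall_congr' fun i => ?_
  rw [disjoint_iff_inf_le]
  cases u i <;> cases v i <;> simp

/-- An instance of the Orthogonal Vectors problem (R. Williams 2005): two lists `A, B` of `n`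
Boolean vectors of dimension `d`, given as tables `Fin n → Fin d → Bool`. [cite: Williams2005] -/
structure OVInstance where
  /-- The number of vectors in each list. -/
  n : ℕ
  /-- The dimension of the vectors. -/
  d : ℕ
  /-- The first list of vectors. -/
  A : Fin n → Fin d → Bool
  /-- The second list of vectors. -/
  B : Fin n → Fin d → Bool

/-- The OV decision question: is there `a ∈ A`, `b ∈ B` with `⟨a, b⟩ = 0`?
(R. Williams 2005.) [cite: Williams2005] -/
def OVInstance.HasOrthogonalPair (I : OVInstance) : Prop :=
  ∃ i j, AreOrthogonal (I.A i) (I.B j)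

/-- `instance` — interim instance carried over undocumented from `harness21/H21/H21/Prelude/CryptoQuantFine/FGCoreProblems.lean:98` (docstring generated by the M5 import). [folklore] -/
instance (I : OVInstance) : Decidable I.HasOrthogonalPair :=
  inferInstanceAs (Decidable (∃ i j, AreOrthogonal (I.A i) (I.B j)))

/-- Swapping the two lists of an OV instance does not change the answer (the outline's
`hasOrthogonalPair_comm`, in bundled form). [folklore] -/
theorem OVInstance.hasOrthogonalPair_swap {n d : ℕ} (A B : Fin n → Fin d → Bool) :
    (⟨n, d, B, A⟩ : OVInstance).HasOrthogonalPair ↔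
      (⟨n, d, A, B⟩ : OVInstance).HasOrthogonalPair :=
  ⟨fun ⟨i, j, h⟩ => ⟨j, i, (areOrthogonal_comm _ _).1 h⟩,
    fun ⟨i, j, h⟩ => ⟨j, i, (areOrthogonal_comm _ _).1 h⟩⟩

/-- An instance of `k`-Orthogonal Vectors (Pătraşcu–Williams 2010; Abboud–Vassilevska Williams
2014): `k` lists, each of `n` Boolean vectors of dimension `d`. [cite: Williams2010] -/
structure KOVInstance (k : ℕ) where
  /-- The number of vectors in each list. -/
  n : ℕ
  /-- The dimension of the vectors. -/
  d : ℕ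
  /-- The `k` lists of vectors: `vecs l i` is the `i`-th vector of the `l`-th list. -/
  vecs : Fin k → Fin n → Fin d → Bool

/-- The `k`-OV decision question: is there a choice of one vector from each list whose
coordinatewise product is identically zero, i.e. for every coordinate `t` some chosen vector has a
`false` at `t`? (Pătraşcu–Williams 2010.) [cite: Williams2010] -/
def KOVInstance.HasOrthogonalTuple {k : ℕ} (I : KOVInstance k) : Prop :=
  ∃ c : Fin k → Fin I.n, ∀ t : Fin I.d, ∃ l : Fin k, I.vecs l (c l) t = false

/-- `instance` — interim instance carried over undocumented from `harness21/H21/H21/Prelude/CryptoQuantFine/FGCoreProblems.lean:125` (docstring generated by the M5 import). [folklore] -/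
instance {k : ℕ} (I : KOVInstance k) : Decidable I.HasOrthogonalTuple :=
  inferInstanceAs
    (Decidable (∃ c : Fin k → Fin I.n, ∀ t : Fin I.d, ∃ l : Fin k, I.vecs l (c l) t = false))

/-! ### 3SUM and `k`-SUM -/

/-- The 3SUM question (Gajentaan–Overmars 1995): does the list `l` of integers contain three
entries at distinct positions `i < j < k` summing to `0`? [cite: GajentaanOvermars1995] -/
def HasThreeSum (l : List ℤ) : Prop :=
  ∃ i j k : Fin l.length, i < j ∧ j < k ∧ l.get i + l.get j + l.get k = 0

/-- `instance` — interim instance carried over undocumented from `harness21/H21/H21/Prelude/CryptoQuantFine/FGCoreProblems.lean:136` (docstring generated by the M5 import). [folklore] -/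
instance (l : List ℤ) : Decidable (HasThreeSum l) :=
  inferInstanceAs
    (Decidable (∃ i j k : Fin l.length, i < j ∧ j < k ∧ l.get i + l.get j + l.get k = 0))

/-- The `k`-SUM question (Pătraşcu–Williams 2010): does the list `l` of integers contain `k`
entries at distinct positions summing to `0`? Junk value: `HasKSum 0 l` is always true (empty
sum); statements use `k ≥ 3`. [cite: Williams2010] -/
def HasKSum (k : ℕ) (l : List ℤ) : Prop :=
  ∃ s : Finset (Fin l.length), s.card = k ∧ ∑ i ∈ s, l.get i = 0

/-- `instance` — interim instance carried over undocumented from `harness21/H21/H21/Prelude/CryptoQuantFine/FGCoreProblems.lean:146` (docstring generated by the M5 import). [folklore] -/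
instance (k : ℕ) (l : List ℤ) : Decidable (HasKSum k l) :=
  inferInstanceAs (Decidable (∃ s : Finset (Fin l.length), s.card = k ∧ ∑ i ∈ s, l.get i = 0))

/-- All entries of the integer list `l` lie in `[-M, M]` (the standard 3SUM/`k`-SUM promise that
inputs are polynomially bounded; Pătraşcu–Williams 2010). [cite: Williams2010] -/
def HasBoundedEntries (l : List ℤ) (M : ℕ) : Prop :=
  ∀ z ∈ l, |z| ≤ M

/-- `instance` — interim instance carried over undocumented from `harness21/H21/H21/Prelude/CryptoQuantFine/FGCoreProblems.lean:154` (docstring generated by the M5 import). [folklore] -/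
instance (l : List ℤ) (M : ℕ) : Decidable (HasBoundedEntries l M) :=
  inferInstanceAs (Decidable (∀ z ∈ l, |z| ≤ M))

/-- 3SUM is `3`-SUM. [folklore] -/
theorem hasThreeSum_iff_hasKSum_three (l : List ℤ) : HasThreeSum l ↔ HasKSum 3 l := by
  constructor
  · rintro ⟨i, j, k, hij, hjk, h⟩
    refine ⟨{i, j, k}, ?_, ?_⟩
    · rw [Finset.card_eq_three]
      exact ⟨i, j, k, hij.ne, (hij.trans hjk).ne, hjk.ne, rfl⟩
    · rw [Finset.sum_insert (by simp [hij.ne, (hij.trans hjk).ne]),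
        Finset.sum_pair hjk.ne, ← add_assoc, h]
  · rintro ⟨s, hs, h⟩
    -- sort the three positions
    suffices key : ∀ a b c : Fin l.length, a < b → b < c →
        l.get a + l.get b + l.get c = 0 → HasThreeSum l by
      obtain ⟨a, b, c, hab, hac, hbc, rfl⟩ := Finset.card_eq_three.1 hs
      rw [Finset.sum_insert (by simp [hab, hac]), Finset.sum_pair hbc, ← add_assoc] at h
      rcases lt_trichotomy a b with hab' | hab' | hab'
      · rcases lt_trichotomy b c with hbc' | hbc' | hbc'
        · exact key a b c hab' hbc' h
        · exact absurd hbc' hbc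
        · rcases lt_trichotomy a c with hac' | hac' | hac'
          · exact key a c b hac' hbc' (by omega)
          · exact absurd hac' hac
          · exact key c a b hac' hab' (by omega)
      · exact absurd hab' hab
      · rcases lt_trichotomy a c with hac' | hac' | hac'
        · exact key b a c hab' hac' (by omega)
        · exact absurd hac' hac
        · rcases lt_trichotomy b c with hbc' | hbc' | hbc'
          · exact key b c a hbc' hac' (by omega)
          · exact absurd hbc' hbc
          · exact key c b a hbc' hab' (by omega)
    intro a b c hab hbc habc
    exact ⟨a, b, c, hab, hbc, habc⟩

/-! ### Dominating set and clique -/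

/-- `S` is a *dominating set* of the simple graph `G`: every vertex is in `S` or adjacent to a
vertex of `S` (Pătraşcu–Williams 2010, `k`-Dominating Set). Mathlib has no such notion at this
pin. [cite: Williams2010, k -Dominating Set] -/
def IsDominatingSet {V : Type*} (G : SimpleGraph V) (S : Set V) : Prop :=
  ∀ v, v ∈ S ∨ ∃ u ∈ S, G.Adj u v

/-- The `k`-Dominating Set question (Pătraşcu–Williams 2010): does `G` have a dominating set of
at most `k` vertices? Junk value: trivially true for every `k` when `V` is empty (the empty set
dominates the empty graph). [cite: Williams2010] -/
def HasDominatingSetOfCard {V : Type*} (G : SimpleGraph V) (k : ℕ) : Prop :=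
  ∃ S : Finset V, S.card ≤ k ∧ IsDominatingSet G (S : Set V)

/-- The `k`-Clique question (Chen–Huang–Kanj–Xia 2006): does `G` contain a `k`-clique? Defined via
Mathlib's `SimpleGraph.CliqueFree`. [cite: ChenHuangKanjXia2006] -/
def HasKClique {V : Type*} (G : SimpleGraph V) (k : ℕ) : Prop :=
  ¬ G.CliqueFree k

/-- `HasKClique` unfolds to the existence of an `n`-clique (`SimpleGraph.IsNClique`). [folklore] -/
theorem hasKClique_iff {V : Type*} (G : SimpleGraph V) (k : ℕ) :
    HasKClique G k ↔ ∃ s : Finset V, G.IsNClique k s := by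
  simp [HasKClique, SimpleGraph.CliqueFree]

/-! ### Boolean-function forms of OV -/

/-- Decode a bit string indexed by `Fin 2 × Fin n × Fin d` into an OV instance: index `0` gives
list `A`, index `1` gives list `B` (Choudhury et al. 2026). [cite: ChoudhuryEtAl2026] -/
def OVInstance.ofBits (n d : ℕ) (x : Fin 2 × Fin n × Fin d → Bool) : OVInstance where
  n := n
  d := d
  A := fun i t => x (0, i, t)
  B := fun i t => x (1, i, t)

/-- The Boolean function `OV_{n,d} : {0,1}^{2nd} → {0,1}`: `true` iff the encoded pair of lists has
an orthogonal pair (Choudhury et al. 2026). [cite: ChoudhuryEtAl2026] -/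
def ovFn (n d : ℕ) (x : Fin 2 × Fin n × Fin d → Bool) : Bool :=
  decide (OVInstance.ofBits n d x).HasOrthogonalPair

/-- The negated Boolean function `¬OV_{n,d}`; this is the monotone form used in circuit lower-bound
statements (Choudhury et al. 2026). [cite: ChoudhuryEtAl2026] -/
def notOVFn (n d : ℕ) : (Fin 2 × Fin n × Fin d → Bool) → Bool :=
  fun x => !(ovFn n d x)

/-- `¬OV` is a monotone Boolean function: raising input bits can only destroy orthogonal pairs
(Choudhury et al. 2026). [cite: ChoudhuryEtAl2026] -/
theorem notOVFn_monotone (n d : ℕ) : Monotone (notOVFn n d) := by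
  intro x y hxy
  have key : (OVInstance.ofBits n d y).HasOrthogonalPair →
      (OVInstance.ofBits n d x).HasOrthogonalPair := by
    rintro ⟨i, j, h⟩
    refine ⟨i, j, fun t ht => h t ⟨?_, ?_⟩⟩
    · have := Bool.le_iff_imp.1 (hxy (0, i, t)); simp only [OVInstance.ofBits] at ht ⊢
      exact this ht.1
    · have := Bool.le_iff_imp.1 (hxy (1, j, t)); simp only [OVInstance.ofBits] at ht ⊢
      exact this ht.2
  simp only [notOVFn, ovFn]
  cases hx : decide (OVInstance.ofBits n d x).HasOrthogonalPair <;>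
    cases hy : decide (OVInstance.ofBits n d y).HasOrthogonalPair <;> simp_all

/-- `¬OV_{n,d}` is non-constant as soon as `n, d ≥ 1` (the all-`false` input has an orthogonal
pair, the all-`true` input has none). [folklore] -/
theorem notOVFn_nonconst {n d : ℕ} (hn : 1 ≤ n) (hd : 1 ≤ d) :
    ∃ x y, notOVFn n d x ≠ notOVFn n d y := by
  classical
  refine ⟨fun _ => false, fun _ => true, ?_⟩
  have h1 : (OVInstance.ofBits n d fun _ => false).HasOrthogonalPair :=
    ⟨⟨0, hn⟩, ⟨0, hn⟩, fun _ h => by simp [OVInstance.ofBits] at h⟩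
  have h2 : ¬ (OVInstance.ofBits n d fun _ => true).HasOrthogonalPair := by
    rintro ⟨i, j, h⟩
    exact h ⟨0, hd⟩ ⟨rfl, rfl⟩
  simp [notOVFn, ovFn, h1, h2]

end Literature.Computability.Cryptography
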